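import Summits.QuantumAdvantage.QuantumAdvantage.Theorems.CharDialSchedCounterSubcube
import Summits.QuantumAdvantage.QuantumAdvantage.Theorems.CharDialPrefixUnread
import HarnessLib
import Summits.QuantumAdvantage.AdviceFreeQNC0.LinFormsRegular

/-!
# E3 «promise deferral» — prefix counters with FUTURE one-reads lose (decomp-qadv lens-6 g14, tree part 25)

**`JLinPeel.prefixFutureRead_hard_unif`** (prime `p ≠ 3`) = the g13 typed target `JLinPeel.PrefixFutureReadHard p`
(g13/g14probe/OneRead.lean, restated here as a theorem body): junta ⊕ linear-form data `D : JLinData p n` whose forms are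
PREFIX COUNTERS (`D.a g = t_g·𝟙_{[0,g)}`), whose juntas have at most ONE element, and for which at some time `m` at least
`m₀(p) = 6912·p³` positions `j ≥ m` have all their readers at cut times `≤ m`, win α's u-walk game on at most `(5/6)·2ⁿ`
inputs — ONE `θ`, ONE `m₀`, every `n`, every charge.

PROOF (the reduction announced in part 24's docstring, `Theorems.CharDialSchedCounterSubcube[A]`, both LANDED).  Freeze every position
outside `F = {j ≥ m : all readers of j are ≤ m}` (`subcubeMerge W b`, `W = Fᶜ`).  On the subcube:
* a cut whose read position is frozen (or which reads nothing) is a pure counter cut: `A_g(form) ⊕ (b_j ∧ B_g(form))`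
  (`yC`, `h_of_junta_single`, `form_prefix`);
* a cut `g` reading a FREE position `j` sits at a time `g ≤ m ≤ j` with every earlier position frozen, so its form value,
  its label `ℓ_g = g + W_{<g}` and hence its `B`-bit `β_g` are CONSTANTS of the subcube: it fires `A_g(form)` now and its
  read contributes `u_j · β_g · e(ℓ_g)` to the final register — a PROMISE, collected per position into the deterministic
  schedule `τ_j = ⊕_{g reads j} β_g·e(ℓ_g) ∈ V₄` (`τF`, stored as two parities; `ev_τF`);
* the win bit is a parity, hence additive (`ringWinU_xor`): WIN = WIN(counter part) ⊕ parity of the kept promises, and the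
  scheduled register of part 24 is the plain register ⊕ the cumulative schedule (`regTp_eq_bx`, `ev_cum`); so
  `LOSE(u) ⟺ (register, label)` of the SCHEDULED process at the end lies in `L_{(n−c,0)}` (`lose_iff_memT`), and part 24's
  `schedSubcube_sharp` bounds the wins on the subcube by `(2/3 + 4p√(12p/(|F|+1)))·2ⁿ` (`futureReadSubcube_le`);
* fibre counting over the frozen patterns (`JLinPeel.sum_card_subcube`).
WHAT THIS IS NOT: past reads (memory) and reads made inside the free segment are not covered (the «SliceDial» g14 annex
types what remains: the THIN-ARC core); CharDial's item `WalkHardFJLinOdd` is untouched; separation NOT moved.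
-/

namespace Summit.QuantumAdvantage.AdviceFreeQNC0

open Finset AffBells22

/-! ## §1 The cumulative schedule: scheduled register = plain register ⊕ the kept promises -/

namespace CounterLaw

/-- `ev` is additive under `bx`. -/
theorem ev_bx (r s : Bool × Bool) (a : ZMod 3) : ev (bx r s) a = xor (ev r a) (ev s a) := by
  revert r s a; decide

/-- the zero register evaluates to `false`. -/
theorem ev_zero (a : ZMod 3) : ev (false, false) a = false := by
  revert a; decide

/-- `e(ℓ) = tog ℓ 0` evaluates to `[a ≠ ℓ]`. -/
theorem ev_tog_zero (ℓ a : ZMod 3) : ev (tog ℓ (false, false)) a = decide (a ≠ ℓ) := by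
  revert ℓ a; decide

/-- CharDialFutureReadA helper `bx_comm` (decomp-qadv land package; see the module docstring). -/
theorem bx_comm (r s : Bool × Bool) : bx r s = bx s r := by
  rcases r with ⟨a, b⟩; rcases s with ⟨c, d⟩; simp [bx, Bool.xor_comm]

/-- CharDialFutureReadA helper `bx_assoc` (decomp-qadv land package; see the module docstring). -/
theorem bx_assoc (r s t : Bool × Bool) : bx (bx r s) t = bx r (bx s t) := by
  rcases r with ⟨a, b⟩; rcases s with ⟨c, d⟩; rcases t with ⟨e, f⟩; simp [bx]

/-- fires commute with alien toggles. -/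
theorem tog_bx (a : ZMod 3) (r s : Bool × Bool) : tog a (bx r s) = bx (tog a r) s := by
  rw [tog_eq_bx, tog_eq_bx, bx_assoc, bx_assoc, bx_comm s]

section Cum

variable {n : ℕ} (p : ℕ) (y : Fin (n + 1) → (Fin n → Bool) → Bool) (τ : Fin n → Bool × Bool)

/-- the cumulative scheduled toggle of the bits `< t`. -/
def cum (u : Fin n → Bool) : ℕ → Bool × Bool
  | 0 => (false, false)
  | t + 1 => bx (cum u t) (sched τ u t)

/-- **register decomposition**: the scheduled register before cut `t` is the plain register ⊕ the cumulative schedule. -/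
theorem regT_eq_bx (u : Fin n → Bool) : ∀ t : ℕ, regT p y τ u t = bx (regN p y u t) (cum τ u t)
  | 0 => by simp [regT, regN, cum]
  | t + 1 => by
    rw [regT_succ]
    simp only [regTp, regN, cum, regT_eq_bx u t]
    cases firedN p y u t
    · simp [bx_assoc]
    · simp [tog_bx, bx_assoc]

/-- the same after the fire decision of cut `t`. -/
theorem regTp_eq_bx (u : Fin n → Bool) (t : ℕ) : regTp p y τ u t = bx (regN p y u (t + 1)) (cum τ u t) := by
  simp only [regTp, regN, regT_eq_bx p y τ u t]
  cases firedN p y u t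
  · simp
  · simp [tog_bx]

/-- the cumulative schedule evaluated at `a`: the parity of the consumed `1`-bits whose toggle is seen at `a`. -/
theorem ev_cum (u : Fin n → Bool) (a : ZMod 3) : ∀ t : ℕ,
    ev (cum τ u t) a = decide ((univ.filter fun i : Fin n => i.val < t ∧ u i = true ∧ ev (τ i) a = true).card % 2 = 1)
  | 0 => by
    have h0 : (univ.filter fun i : Fin n => i.val < 0 ∧ u i = true ∧ ev (τ i) a = true) = ∅ :=
      filter_eq_empty_iff.2 fun i _ h => Nat.not_lt_zero _ h.1
    simp [cum, ev_zero]
  | t + 1 => by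
    rw [cum, ev_bx, ev_cum u a t]
    by_cases ht : t < n
    · -- the new bit is `i₀ = ⟨t, ht⟩`
      set i₀ : Fin n := ⟨t, ht⟩
      have hsplit : (univ.filter fun i : Fin n => i.val < t + 1 ∧ u i = true ∧ ev (τ i) a = true)
          = (univ.filter fun i : Fin n => i.val < t ∧ u i = true ∧ ev (τ i) a = true) ∪
            (univ.filter fun i : Fin n => i = i₀ ∧ u i = true ∧ ev (τ i) a = true) := by
        ext i
        simp only [mem_filter, mem_univ, true_and, mem_union]
        constructor
        · rintro ⟨hi, hu, he⟩
          rcases Nat.lt_succ_iff_lt_or_eq.1 hi with h | h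
          · exact Or.inl ⟨h, hu, he⟩
          · exact Or.inr ⟨Fin.ext h, hu, he⟩
        · rintro (⟨h, hu, he⟩ | ⟨h, hu, he⟩)
          · exact ⟨Nat.lt_succ_of_lt h, hu, he⟩
          · exact ⟨by rw [h]; exact Nat.lt_succ_self t, hu, he⟩
      have hdisj : Disjoint (univ.filter fun i : Fin n => i.val < t ∧ u i = true ∧ ev (τ i) a = true)
          (univ.filter fun i : Fin n => i = i₀ ∧ u i = true ∧ ev (τ i) a = true) := by
        rw [disjoint_filter]
        rintro i _ ⟨hi, _⟩ ⟨rfl, _⟩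
        exact lt_irrefl _ hi
      rw [hsplit, card_union_of_disjoint hdisj]
      have hs : sched τ u t = if u i₀ then τ i₀ else (false, false) := by simp [sched, ht, i₀]
      rw [hs]
      set N := (univ.filter fun i : Fin n => i.val < t ∧ u i = true ∧ ev (τ i) a = true).card
      by_cases hui : u i₀ = true ∧ ev (τ i₀) a = true
      · have h1 : (univ.filter fun i : Fin n => i = i₀ ∧ u i = true ∧ ev (τ i) a = true) = {i₀} := by
          ext i; simp only [mem_filter, mem_univ, true_and, mem_singleton]
          constructor
          · exact fun h => h.1
          · rintro rfl; exact ⟨rfl, hui⟩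
        rw [h1, card_singleton, if_pos hui.1, hui.2]
        rcases Nat.mod_two_eq_zero_or_one N with h | h <;> simp [h, Nat.add_mod]
      · have h0 : (univ.filter fun i : Fin n => i = i₀ ∧ u i = true ∧ ev (τ i) a = true) = ∅ :=
          filter_eq_empty_iff.2 fun i _ h => hui (by rw [← h.1]; exact h.2)
        rw [h0, card_empty, add_zero]
        have hz : ev (if u i₀ = true then τ i₀ else (false, false)) a = false := by
          by_cases hu : u i₀ = true
          · rw [if_pos hu]
            cases he : ev (τ i₀) a
            · rfl
            · exact absurd ⟨hu, he⟩ hui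
          · rw [if_neg hu, ev_zero]
        rw [hz, Bool.xor_false]
    · have hs : sched τ u t = (false, false) := by simp [sched, ht]
      have hsame : (univ.filter fun i : Fin n => i.val < t + 1 ∧ u i = true ∧ ev (τ i) a = true)
          = univ.filter fun i : Fin n => i.val < t ∧ u i = true ∧ ev (τ i) a = true := by
        ext i
        simp only [mem_filter, mem_univ, true_and]
        constructor
        · rintro ⟨_, hu, he⟩; exact ⟨by omega, hu, he⟩
        · rintro ⟨_, hu, he⟩; exact ⟨by omega, hu, he⟩
      rw [hs, ev_zero, Bool.xor_false, hsame]

end Cum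

/-! ## §2 Game-side facts: the win parity is additive; the column condition in label form -/

section Game

variable {n : ℕ}

/-- parity of a XOR-filter = sum of the parities. -/
theorem card_filter_xor_mod_two {α : Type*} (s : Finset α) (a b : α → Bool) (P : α → Prop) [DecidablePred P] :
    (s.filter fun g => xor (a g) (b g) = true ∧ P g).card % 2
      = ((s.filter fun g => a g = true ∧ P g).card + (s.filter fun g => b g = true ∧ P g).card) % 2 := by
  classical
  have key : (s.filter fun g => xor (a g) (b g) = true ∧ P g).card
      + 2 * (s.filter fun g => (a g = true ∧ b g = true) ∧ P g).card
      = (s.filter fun g => a g = true ∧ P g).card + (s.filter fun g => b g = true ∧ P g).card := by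
    simp only [card_filter, mul_sum, ← sum_add_distrib]
    refine sum_congr rfl fun g _ => ?_
    by_cases hx : P g
    · cases a g <;> cases b g <;> simp [hx]
    · simp [hx]
  omega

/-- **the win bit is additive** under pointwise XOR of strategies (the win predicate is a parity). -/
theorem ringWinU_xor (c : ℕ) (y₁ y₂ : Fin (n + 1) → (Fin n → Bool) → Bool) (u : Fin n → Bool) :
    ringWinU c (fun g v => xor (y₁ g v) (y₂ g v)) u = xor (ringWinU c y₁ u) (ringWinU c y₂ u) := by
  classical
  have hx := card_filter_xor_mod_two (univ : Finset (Fin (n + 1))) (fun g => y₁ g u) (fun g => y₂ g u)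
    (fun g => (c + g.val + walkExp u g.val) % 3 ≠ 0)
  unfold ringWinU
  simp only [] at hx ⊢
  rw [hx]
  rcases Nat.mod_two_eq_zero_or_one (univ.filter fun g : Fin (n + 1) =>
      y₁ g u = true ∧ (c + g.val + walkExp u g.val) % 3 ≠ 0).card with h1 | h1 <;>
  rcases Nat.mod_two_eq_zero_or_one (univ.filter fun g : Fin (n + 1) =>
      y₂ g u = true ∧ (c + g.val + walkExp u g.val) % 3 ≠ 0).card with h2 | h2 <;>
  · rw [Nat.add_mod, h1, h2]; simp

/-- the column condition of cut `g` in label form: `lab_g ≠ (n − c) − lab_n`. -/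
theorem col_iff (c : ℕ) (u : Fin n → Bool) (g : Fin (n + 1)) :
    (c + g.val + walkExp u g.val) % 3 ≠ 0 ↔ labN u g.val ≠ (((n : ℕ) : ZMod 3) - c) - labN u n := by
  unfold labN walkExp
  rw [ConstBells.wtPrefix_self, not_iff_not]
  rw [show (c + g.val + (wt u + wtPrefix u g.val)) % 3 = 0 ↔ (((c + g.val + (wt u + wtPrefix u g.val) : ℕ) : ZMod 3)) = 0
    from by rw [ZMod.natCast_eq_zero_iff, Nat.dvd_iff_mod_eq_zero]]
  push_cast
  constructor
  · intro h; linear_combination h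
  · intro h; linear_combination h

/-- the win bit of ANY strategy as a label-form parity. -/
theorem ringWinU_eq_lab (c : ℕ) (y : Fin (n + 1) → (Fin n → Bool) → Bool) (u : Fin n → Bool) :
    ringWinU c y u = decide ((univ.filter fun g : Fin (n + 1) =>
      y g u = true ∧ labN u g.val ≠ (((n : ℕ) : ZMod 3) - c) - labN u n).card % 2 = 1) := by
  unfold ringWinU
  rw [filter_congr (fun g _ => and_congr_right (fun _ => col_iff c u g))]

/-- the win bit of a COUNTER strategy as a register evaluation (from `lose_iff`). -/
theorem ringWinU_eq_ev (p : ℕ) (y : Fin (n + 1) → (Fin n → Bool) → Bool)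
    (hy : ∀ g : Fin (n + 1), ∀ u v : Fin n → Bool, wtPrefix u g.val % p = wtPrefix v g.val % p → y g u = y g v)
    (c : ℕ) (u : Fin n → Bool) :
    ringWinU c y u = ev (regN p y u (n + 1)) ((((n : ℕ) : ZMod 3) - c) - labN u n) := by
  have h := lose_iff p y hy c u
  simp only [mem, patVal, Xp] at h
  cases hw : ringWinU c y u <;> cases hev : ev (regN p y u (n + 1)) ((((n : ℕ) : ZMod 3) - c) - labN u n)
  · rfl
  · rw [hw, hev] at h; simp at h
  · rw [hw, hev] at h; simp at h
  · rfl

/-- prefix weights read only the prefix. -/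
theorem wtPrefix_congr {u v : Fin n → Bool} {g : ℕ} (h : ∀ i : Fin n, i.val < g → u i = v i) :
    wtPrefix u g = wtPrefix v g := by
  unfold wtPrefix
  congr 1; ext i
  simp only [mem_filter, mem_univ, true_and]
  constructor
  · rintro ⟨hi, hu⟩; exact ⟨hi, (h i hi) ▸ hu⟩
  · rintro ⟨hi, hv⟩; exact ⟨hi, (h i hi).symm ▸ hv⟩

/-- `Σ f ≡ #{odd terms} (mod 2)`. -/
theorem sum_mod_two_eq_card_odd {α : Type*} [DecidableEq α] (s : Finset α) (f : α → ℕ) :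
    (∑ i ∈ s, f i) % 2 = (s.filter fun i => f i % 2 = 1).card % 2 := by
  induction s using Finset.induction_on with
  | empty => simp
  | insert a s ha ih =>
    rw [sum_insert ha, filter_insert, Nat.add_mod, ih]
    by_cases hf : f a % 2 = 1
    · rw [if_pos hf, card_insert_of_notMem (fun h => ha (mem_filter.1 h).1), hf]
      omega
    · rw [if_neg hf]
      have h0 : f a % 2 = 0 := by omega
      rw [h0, zero_add, Nat.mod_mod]

end Game

end CounterLaw

/-! ## §3 One-read data: tables and the read position -/

namespace JLinPeel

open CounterLaw

section OneRead

variable {p n : ℕ}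

/-- the counter-only tables of a one-read cut: `A g s` = the answer when the read bit is `false` … -/
def tabA (D : JLinData p n) (g : Fin (n + 1)) (s : ZMod p) : Bool := D.h g (fun _ => false) s

/-- … and `B g j s` = the XOR of the two answers. -/
def tabB (D : JLinData p n) (g : Fin (n + 1)) (j : Fin n) (s : ZMod p) : Bool :=
  xor (D.h g (Function.update (fun _ => false) j true) s) (D.h g (fun _ => false) s)

/-- a cut whose junta is empty answers by the counter alone. -/
theorem h_of_junta_empty (D : JLinData p n) {g : Fin (n + 1)} (hJ : D.J g = ∅) (u : Fin n → Bool) (s : ZMod p) :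
    D.h g u s = tabA D g s :=
  D.hJ g u (fun _ => false) (by simp [hJ]) s

/-- a cut whose junta is `{j}` answers `A(s) ⊕ (u j ∧ B(s))`. -/
theorem h_of_junta_single (D : JLinData p n) {g : Fin (n + 1)} {j : Fin n} (hJ : D.J g = {j}) (u : Fin n → Bool)
    (s : ZMod p) : D.h g u s = xor (tabA D g s) (u j && tabB D g j s) := by
  have e : D.h g u s = D.h g (Function.update (fun _ => false) j (u j)) s :=
    D.hJ g u _ (fun i hi => by rw [hJ, mem_singleton] at hi; subst hi; simp) s
  rw [e]; unfold tabA tabB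
  cases hu : u j
  · have e0 : Function.update (fun _ : Fin n => false) j false = fun _ => false := by
      ext i; by_cases h : i = j <;> simp [Function.update, h]
    rw [e0]; simp
  · cases D.h g (Function.update (fun _ => false) j true) s <;> cases D.h g (fun _ => false) s <;> rfl

/-- the read position of cut `g` (`none` when the junta is empty). -/
noncomputable def readPos (D : JLinData p n) (g : Fin (n + 1)) : Option (Fin n) :=
  if h : (D.J g).Nonempty then some h.choose else none

/-- CharDialFutureReadA helper `junta_of_readPos_some` (decomp-qadv land package; see the module docstring). -/
theorem junta_of_readPos_some (D : JLinData p n) (hJ1 : ∀ g, (D.J g).card ≤ 1) {g : Fin (n + 1)} {j : Fin n}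
    (h : readPos D g = some j) : D.J g = {j} := by
  unfold readPos at h
  by_cases hne : (D.J g).Nonempty
  · rw [dif_pos hne, Option.some.injEq] at h
    apply eq_singleton_iff_unique_mem.2 ⟨h ▸ hne.choose_spec, fun i hi => ?_⟩
    exact h ▸ card_le_one.1 (hJ1 g) i hi _ hne.choose_spec
  · rw [dif_neg hne] at h; exact absurd h (by simp)

/-- CharDialFutureReadA helper `junta_of_readPos_none` (decomp-qadv land package; see the module docstring). -/
theorem junta_of_readPos_none (D : JLinData p n) {g : Fin (n + 1)} (h : readPos D g = none) : D.J g = ∅ := by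
  unfold readPos at h
  by_cases hne : (D.J g).Nonempty
  · rw [dif_pos hne] at h; exact absurd h (by simp)
  · exact not_nonempty_iff_eq_empty.1 hne

end OneRead

/-! ## §4 The reduction on a subcube — generic ONE-READ COUNTER SOURCES

A one-read counter source is `(A, B, rp, φ)`: cut `g` answers `A g (φ g v) ⊕ [rp g = some j]·(v j ∧ B g j (φ g v))` where the
«form» `φ g` is any counter statistic mod `p` (a function of `W_{<g} mod p`).  Prefix one-read `JLinData` are the case
`φ = D.form` (§5); SUFFIX data on a counter slice are the case `φ g v = t_g·(K + σ − W_{<g})` (part 26). -/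

section Generic

variable {p n : ℕ} (A : Fin (n + 1) → ZMod p → Bool) (B : Fin (n + 1) → Fin n → ZMod p → Bool)
  (rp : Fin (n + 1) → Option (Fin n)) (φ : Fin (n + 1) → (Fin n → Bool) → ZMod p)
  (W : Finset (Fin n)) (b : Fin n → Bool)

/-- the strategy of a one-read counter source. -/
def str : Fin (n + 1) → (Fin n → Bool) → Bool := fun g v =>
  xor (A g (φ g v)) (match rp g with | some j => v j && B g j (φ g v) | none => false)


end Generic
end JLinPeel
end Summit.QuantumAdvantage.AdviceFreeQNC0
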